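import Mathlib.Analysis.Asymptotics.SpecificAsymptotics
import Literature.Computability.Complexity.TimeHierarchyProofs
import Literature.Computability.Complexity.NPSubsetNTIME
import Literature.Computability.Complexity.NondeterministicProofs
import HarnessLib

/-!
# No fixed polynomial time bound exhausts `P`: `DTIME(nᵏ) ⊊ P`, hence `NP ⊄ DTIME(n)`

Literature / complexity toolkit (theorems only; no notion, definition or named fact is introduced).
Consequences of the tree's PROVED deterministic time hierarchy machinery
(`TimeHierarchyDiagonal.lean`, `TimeHierarchyMeter.lean`, `TimeHierarchyInterpreter.lean`,
`TimeHierarchyProofs.lean`: Hartmanis–Stearns 1965, Thm. 9 / Cor. 9.1; Arora–Barak 2009, Thm. 3.1)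
for the tree's classes `DTIME`, `P`, `NP` over Mathlib's multi-stack `TM2` machines:

* `FuelledSimulator.diagLang_pow_mem_P` — the diagonal language of a fuelled universal decider
  with the polynomial fuel `U(n) = nᵐ` is in `P` (the `FP` clock `x ↦ ⟨x, 1^{|x|ᵐ}⟩`, `Plumb.polyFn`,
  followed by the linear-time simulator, `Turing.TM2ComputableAux.comp`);
* `exists_mem_P_not_mem_DTIME_pow` — **for every `k` there is `L ∈ P` with `L ∉ DTIME(nᵏ)`**
  (diagonal language with fuel `n^{2k+3}` against `DTIME(n^{k+1}) ⊇ DTIME(nᵏ)`; the lower bound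
  `FuelledSimulator.diagLang_not_mem_DTIME` needs no time-constructibility, only
  `(n^{k+1})² / n^{2k+3} → 0`), with the corollaries `not_P_subset_DTIME_pow`,
  `DTIME_pow_ssubset_P : DTIME(nᵏ) ⊊ P` (Hartmanis–Stearns 1965, Cor. 9.1 for `T = nᵏ`,
  `U = n^{2k+1}`; Arora–Barak 2009, Thm. 3.1: "`DTIME(n^c) ⊊ DTIME(n^d)` for `c < d`", whence
  `P ≠ DTIME(nᵏ)`; Homer–Selman 2011, §5.2);
* `exists_mem_NP_not_mem_DTIME_pow`, **`exists_mem_NP_not_mem_DTIME_id : ∃ L ∈ NP, L ∉ DTIME(n)`**,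
  `not_NP_subset_DTIME_id` — by `P ⊆ NP` (`P_subset_NP_holds`). This is the elementary
  (hierarchy) form of "some `NP` language is not decidable in deterministic linear time"; the deep
  form for LINEAR nondeterministic time, `NTIME(n) ≠ DTIME(n)` for multitape Turing machines, is
  Paul–Pippenger–Szemerédi–Trotter 1983 and is NOT what is proved here.

## References

* J. Hartmanis, R. E. Stearns, *On the computational complexity of algorithms*, Trans. Amer.
  Math. Soc. 117 (1965) 285–306, Thm. 9, Cor. 9.1 [HartmanisStearns1965].
* S. Arora, B. Barak, *Computational Complexity: A Modern Approach*, CUP 2009, Thm. 3.1 (Time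
  Hierarchy Theorem) and the remark following it, Claim 2.4 (`P ⊆ NP`) [AroraBarakCC2009].
* S. Homer, A. L. Selman, *Computability and Complexity Theory*, 2nd ed., Springer 2011, §5.2
  (p. 84 of the PDF: "`DTIME(n) ≠ NTIME(n)`", citing [PPST83]) [HomerSelman2011].
* W. J. Paul, N. Pippenger, E. Szemerédi, W. T. Trotter, *On determinism versus non-determinism
  and related problems*, FOCS 1983, 429–438 [PaulEtAl1983].
-/

namespace Literature.Computability.Complexity

open _root_.Computability Turing Filter Topology Polynomial

/-! ### The polynomial clock and the upper bound -/

/-- **The polynomial clock `x ↦ ⟨x, 1^{|x|ᵐ}⟩` runs in polynomial time** (the `FP` brick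
`fanoutFn id (Plumb.polyFn (X ^ m))`). [cite: AroraBarakCC2009, §1.3 and Thm. 3.1 (proof: "polynomials are time constructible")] -/
theorem exists_machine_pair_replicate_pow (m : ℕ) :
    ∃ (q : Polynomial ℕ) (N : TM2ComputableAux Bool Bool), ∀ x : List Bool,
      N.OutputsWithin x (boolPair x (List.replicate (x.length ^ m) true)) (q.eval x.length) := by
  have h : fanoutFn id (Plumb.polyFn (X ^ m)) ∈ FP :=
    fanoutFn_mem_FP OracleCompose.id_mem_FP (Plumb.polyFn_mem_FP _)
  obtain ⟨q, N, hN⟩ := h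
  refine ⟨q, N, fun x => ?_⟩
  have := hN x
  simpa [fanoutFn_apply] using this

/-- **The diagonal language with polynomial fuel is in `P`.** For a fuelled universal decider `𝒮`
(`TimeHierarchyDiagonal.lean`) and any `m`, `𝒮.diagLang (· ^ m) = {x | 𝒮.sim x |x|ᵐ = true} ∈ P`:
the clock `x ↦ ⟨x, 1^{|x|ᵐ}⟩` (time `q |x|`) followed by the simulator (time `a (|x| + |x|ᵐ) + a`),
composed with additive running time (`Turing.TM2ComputableAux.comp_outputsWithin`), decides it
within the polynomial `q + a (X + Xᵐ) + a`; then `mem_P_iff_holds`. (Arora–Barak 2009, proof of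
Thm. 3.1: "`D` halts within `n^{1.4}` steps", here with a polynomial in place of `n^{1.4}`.)
[cite: AroraBarakCC2009, Thm. 3.1 (proof)] -/
theorem FuelledSimulator.diagLang_pow_mem_P (𝒮 : FuelledSimulator) (m : ℕ) :
    𝒮.diagLang (fun n => n ^ m) ∈ Classes.P := by
  obtain ⟨q, N, hN⟩ := exists_machine_pair_replicate_pow m
  refine mem_P_iff_holds.2 ⟨q + C 𝒮.a * (X + X ^ m) + C 𝒮.a, N.comp 𝒮.machine, fun x => ?_⟩
  have h₁ := hN x
  have h₂ := 𝒮.outputsWithin x (x.length ^ m)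
  have h := Turing.TM2ComputableAux.comp_outputsWithin _ _ h₁ h₂
  show (N.comp 𝒮.machine).OutputsWithin x
    (encodeBool ((𝒮.diagLang fun n => n ^ m).boolIndicator x)) _
  rw [FuelledSimulator.boolIndicator_diagLang]
  refine h.mono (le_of_eq ?_)
  simp only [id, eval_add, eval_mul, eval_C, eval_X, eval_pow]
  ring

/-! ### The lower bound: room `(n^{k+1})² / n^{2k+3} → 0` -/

/-- `(n^{k+1})² / n^{2k+3} = 1 / n → 0`. [folklore] -/
theorem tendsto_pow_succ_sq_div_pow (k : ℕ) :
    Tendsto (fun n : ℕ => ((n ^ (k + 1) : ℕ) : ℝ) ^ 2 / ((n ^ (2 * k + 3) : ℕ) : ℝ)) atTop (𝓝 0) := by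
  have h := (tendsto_pow_div_pow_atTop_zero (𝕜 := ℝ) (show 2 * k + 2 < 2 * k + 3 by omega)).comp
    tendsto_natCast_atTop_atTop
  refine Tendsto.congr (fun n => ?_) h
  simp only [Function.comp_apply, Nat.cast_pow]
  rw [← pow_mul, show (k + 1) * 2 = 2 * k + 2 by ring]

/-- **For every `k` some language in `P` is not in `DTIME(n^{k+1})`**: the diagonal language of the
tree's fuelled universal decider (`FuelledRun.fuelledSimulator UDet.interp`, `TimeHierarchyProofs.lean`)
with fuel `n^{2k+3}` — in `P` by `FuelledSimulator.diagLang_pow_mem_P`, outside `DTIME(n^{k+1})` by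
the diagonal step `FuelledSimulator.diagLang_not_mem_DTIME` (`T = n^{k+1}`, `U = n^{2k+3}`,
`T² / U → 0`; no time-constructibility is needed for the lower bound).
[cite: HartmanisStearns1965, Thm. 9 / Cor. 9.1] -/
theorem exists_mem_P_not_mem_DTIME_pow_succ (k : ℕ) :
    ∃ L ∈ Classes.P, L ∉ DTIME (fun n => n ^ (k + 1)) := by
  let 𝒮 : FuelledSimulator :=
    FuelledRun.fuelledSimulator UDet.interp UDet.DR.X UDet.DR.ans UDet.interprets
  refine ⟨𝒮.diagLang fun n => n ^ (2 * k + 3), 𝒮.diagLang_pow_mem_P (2 * k + 3), ?_⟩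
  exact 𝒮.diagLang_not_mem_DTIME (T := fun n => n ^ (k + 1)) (U := fun n => n ^ (2 * k + 3))
    (fun n => Nat.le_self_pow (Nat.succ_ne_zero k) n)
    (fun n => Nat.le_self_pow (by omega) n) (tendsto_pow_succ_sq_div_pow k)

/-- `DTIME(nᵏ) ⊆ DTIME(n^{k+1})` (`nᵏ ≤ n^{k+1}` for `n ≥ 1`; the length `0` is absorbed by the
additive constant, `DTIME_subset_DTIME_of_eventually_le`). [cite: AroraBarakCC2009, Def. 1.12] -/
theorem DTIME_pow_subset_DTIME_pow_succ (k : ℕ) :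
    DTIME (fun n => n ^ k) ⊆ DTIME (fun n => n ^ (k + 1)) :=
  DTIME_subset_DTIME_of_eventually_le (N := 1) fun _ hn => Nat.pow_le_pow_right hn (Nat.le_succ k)

/-- **For every `k` some language in `P` is not in `DTIME(nᵏ)`** (Hartmanis–Stearns 1965,
Cor. 9.1 with `T = nᵏ`; Arora–Barak 2009, Thm. 3.1 and the remark after it: `P` is not `DTIME(n^c)`
for any fixed `c`). [cite: HartmanisStearns1965, Thm. 9 / Cor. 9.1] -/
theorem exists_mem_P_not_mem_DTIME_pow (k : ℕ) : ∃ L ∈ Classes.P, L ∉ DTIME (fun n => n ^ k) := by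
  obtain ⟨L, hLP, hL⟩ := exists_mem_P_not_mem_DTIME_pow_succ k
  exact ⟨L, hLP, fun h => hL (DTIME_pow_subset_DTIME_pow_succ k h)⟩

/-- `P ⊄ DTIME(nᵏ)`. [cite: HartmanisStearns1965, Thm. 9 / Cor. 9.1] -/
theorem not_P_subset_DTIME_pow (k : ℕ) : ¬ Classes.P ⊆ DTIME (fun n => n ^ k) := by
  obtain ⟨L, hLP, hL⟩ := exists_mem_P_not_mem_DTIME_pow k
  exact fun h => hL (h hLP)

/-- **`DTIME(nᵏ) ⊊ P`** for every `k` (`DTIME(nᵏ) ⊆ P` by the definition `P = ⋃ₖ DTIME(nᵏ)`).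
[cite: HartmanisStearns1965, Thm. 9 / Cor. 9.1] -/
theorem DTIME_pow_ssubset_P (k : ℕ) : DTIME (fun n => n ^ k) ⊂ Classes.P :=
  ⟨Set.subset_iUnion (fun k : ℕ => DTIME fun n => n ^ k) k, not_P_subset_DTIME_pow k⟩

/-- **Some language in `P` is not decidable in deterministic linear time** (`k = 1`).
[cite: HartmanisStearns1965, Thm. 9 / Cor. 9.1] -/
theorem exists_mem_P_not_mem_DTIME_id : ∃ L ∈ Classes.P, L ∉ DTIME (fun n => n) := by
  simpa only [pow_one] using exists_mem_P_not_mem_DTIME_pow 1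

/-! ### `NP` versions -/

/-- **For every `k` some language in `NP` is not in `DTIME(nᵏ)`** (`P ⊆ NP`, `P_subset_NP_holds`).
[cite: AroraBarakCC2009, Thm. 3.1 and Claim 2.4] -/
theorem exists_mem_NP_not_mem_DTIME_pow (k : ℕ) :
    ∃ L ∈ Nondeterministic.NP, L ∉ DTIME (fun n => n ^ k) := by
  obtain ⟨L, hLP, hL⟩ := exists_mem_P_not_mem_DTIME_pow k
  exact ⟨L, P_subset_NP_holds hLP, hL⟩

/-- **Some language in `NP` is not decidable in deterministic linear time**:
`∃ L ∈ NP, L ∉ DTIME(n)` over the tree's multi-stack `TM2` classes — the elementary form, from the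
deterministic time hierarchy and `P ⊆ NP`. (The deep form `NTIME(n) ≠ DTIME(n)` for multitape
Turing machines is Paul–Pippenger–Szemerédi–Trotter 1983; Homer–Selman 2011, §5.2.)
[cite: AroraBarakCC2009, Thm. 3.1 and Claim 2.4] -/
theorem exists_mem_NP_not_mem_DTIME_id : ∃ L ∈ Nondeterministic.NP, L ∉ DTIME (fun n => n) := by
  obtain ⟨L, hLP, hL⟩ := exists_mem_P_not_mem_DTIME_id
  exact ⟨L, P_subset_NP_holds hLP, hL⟩

/-- `NP ⊄ DTIME(n)`. [cite: AroraBarakCC2009, Thm. 3.1 and Claim 2.4] -/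
theorem not_NP_subset_DTIME_id : ¬ Nondeterministic.NP ⊆ DTIME (fun n => n) := by
  obtain ⟨L, hL, hL'⟩ := exists_mem_NP_not_mem_DTIME_id
  exact fun h => hL' (h hL)

/-- `NP ⊄ DTIME(nᵏ)` for every `k`. [cite: AroraBarakCC2009, Thm. 3.1 and Claim 2.4] -/
theorem not_NP_subset_DTIME_pow (k : ℕ) : ¬ Nondeterministic.NP ⊆ DTIME (fun n => n ^ k) := by
  obtain ⟨L, hL, hL'⟩ := exists_mem_NP_not_mem_DTIME_pow k
  exact fun h => hL' (h hL)

end Literature.Computability.Complexity
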